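import Literature.MathematicalPhysics.QuantumFieldTheory.Balaban1983to89.B4Eq19LatticeOperators

/-!
# `Balaban1983to89.B4Eq19LatticePoincareMorrey` — T. Bałaban, *Propagators and renormalization transformations for lattice gauge theories. II*,
# Commun. Math. Phys. **96** (1984) 223–250 [Balaban1984PropagatorsII] (1.9) p. 226: **THE `ℓ¹` POINCARÉ INEQUALITY ON BOXES OF `ℤ^d` AND MORREY'S
# DYADIC TELESCOPING** — `Σ_{Q_ρ(z)} |u − c_Q| ≤ (2ρ+1)·Σ_{Q_ρ(z)} Σ_μ |∂_μu|` for a suitable constant `c_Q` (one-coordinate averaging), and: if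
# `Σ_{Q_ρ(z)} |∇u|² ≤ N (ρ+1)^{d−1}` for all `ρ ≤ R₀` at the two centres `a`, `x′` (`x′ ∈ Q_{ρ₀}(a)`, `1 ≤ ρ₀`, `2ρ₀ ≤ R₀`), then
# `|u(x′) − u(a)| ≤ C_d √(N (ρ₀+1))` — the Campanato∕Morrey characterisation of Hölder continuity ([Giaquinta1984] Ch. III §1 Thm 1.2 p. 70, Thm 1.3 p. 72)
# on the lattice (exponent `½`); last step of the road to the LOCAL η-scale Hölder estimate `Hloc` of `B9Eq343FlatWindowLetterOfLocalHolder`.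

statement-level skeleton of published theorems with citation tags; proofs where landed; nothing here is a claim about the Yang–Mills mass gap

CITATION HEADER (lean-in-tree rule).  Audit cell `pub-balaban`, sub-cell `t4`, BINDER row NE9; filed by NE9 crux-team LEAF PROVER 01
(`b2b-balaban-t4-ne9-formalise-leaf-01`, gen 94; bears_on: R4/N22).  CONTENT: [folklore] lattice analysis (Poincaré on a product box by averaging one
coordinate at a time; [Giaquinta1984] Ch. III Thm 1.2's integral characterisation of Hölder classes in its dyadic-telescoping proof).  Nothing of
[Balaban1984PropagatorsII] is asserted.

WHAT IS PROVED (sorry-free; proof lane — 0 `def`).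
* `sum_box_lineAvg`, `abs_sub_lineAvg_sum_le` (one-coordinate averaging `x ↦ (2ρ+1)⁻¹ Σ_s u(x[j := s])`: preserves box sums; `ℓ¹` deviation ≤ line variation);
  **`exists_poincare_l1`** — `∃ c, Σ_{Q_ρ(z)} |u − c| ≤ (2ρ+1) Σ_{x ∈ Q_ρ(z)} Σ_μ |∂_μu(x)|`.
* `sum_abs_fdiff_le_sqrt` (`ℓ¹ ≤ √(d·#Q·gradSq)`); **`abs_sub_le_of_nested`** — for `Q_{ρ′}(z′) ⊆ Q_ρ(z)`, `ρ+1 ≤ 2(ρ′+1)`, Poincaré constants `c′, c` and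
  `gradSq u (Q_ρ(z)) ≤ N(ρ+1)^{d−1}`: `|c′ − c| ≤ √(16 d 8^d · N (ρ+1))`.
* **`exists_const_near_value`** — dyadic telescoping at one centre: `∃ c` (Poincaré constant of `Q_ρ(z)`) with `|u(z) − c| ≤ 8√(16 d 8^d) √(N(ρ+1))`.
* **`abs_sub_le_of_morrey`** — THE TWO-CENTRE CONCLUSION `|u(x′) − u(a)| ≤ 17·√(16 d 8^d)·√(N (ρ₀+1))`.
HONEST SCOPE.  [folklore] lattice analysis on `ℤ^d`; one step of the road to `Hloc`; NOT summit progress (cell pub-balaban: NE9 NOT PRINTED ∕ NOT PROVED;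
spine PROVED 0∕9; finite T⁴ — NOT infinite volume, NOT mass gap, NOT BetaPertH, NOT Clay).  NEW file importing `B4Eq19LatticeOperators` only.
Net new unproved facts: 0.
-/

noncomputable section

open scoped BigOperators
open Finset

namespace Literature.MathematicalPhysics.QuantumFieldTheory.Balaban1983to89.B4Eq19LatticePoincareMorrey

open B4Eq19LatticeOperators

variable {d : ℕ}

/-! ## §1 One-coordinate averaging and the `ℓ¹` Poincaré inequality -/

/-- `y[j := s] ∈ Q_ρ(z)` when `y ∈ Q_ρ(z)` and `s ∈ [z_j − ρ, z_j + ρ]`. [folklore] [cite: Giaquinta1984, Ch. III §1 p.64] -/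
theorem update_mem_box {z y : Zd d} {ρ : ℤ} (hy : y ∈ box z ρ) (j : Fin d) {s : ℤ} (hs : s ∈ Finset.Icc (z j - ρ) (z j + ρ)) :
    Function.update y j s ∈ box z ρ := by
  rw [mem_box] at hy ⊢
  intro i
  by_cases hi : i = j
  · subst hi; rw [Function.update_self]; rw [Finset.mem_Icc] at hs; rw [abs_le]; constructor <;> linarith [hs.1, hs.2]
  · rw [Function.update_of_ne hi]; exact hy i

/-- **Box sums are invariant under one-coordinate averaging**: `Σ_{x ∈ Q} Σ_{s ∈ I_j} v(x[j := s]) = (2ρ+1)·Σ_{x ∈ Q} v(x)` (each point of `Q` is hit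
`2ρ+1` times). [folklore] [cite: Giaquinta1984, Ch. III §1 p.65] -/
theorem sum_box_lineAvg (z : Zd d) {ρ : ℤ} (hρ : 0 ≤ ρ) (j : Fin d) (v : Zd d → ℝ) :
    ∑ x ∈ box z ρ, ∑ s ∈ Finset.Icc (z j - ρ) (z j + ρ), v (Function.update x j s) = ((2 * ρ + 1 : ℤ) : ℝ) * ∑ x ∈ box z ρ, v x := by
  classical
  have hn : ((Finset.Icc (z j - ρ) (z j + ρ)).card : ℝ) = ((2 * ρ + 1 : ℤ) : ℝ) := by
    rw [Int.card_Icc, show z j + ρ + 1 - (z j - ρ) = 2 * ρ + 1 by ring]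
    have : (0 : ℤ) ≤ 2 * ρ + 1 := by linarith
    rw [← Int.cast_natCast, Int.toNat_of_nonneg this]
  rw [sum_box_eq_sum_update (α := ℝ) z ρ j (z j) (fun x => ∑ s ∈ Finset.Icc (z j - ρ) (z j + ρ), v (Function.update x j s)),
    sum_box_eq_sum_update (α := ℝ) z ρ j (z j) v]
  simp only [Function.update_idem]
  rw [Finset.sum_const, nsmul_eq_mul, hn]
  congr 1
  exact Finset.sum_comm

/-- **The `ℓ¹` deviation from the line average is at most the line variation**: for `x ∈ Q_ρ(z)`,
`Σ_{s ∈ I_j} |v(x) − v(x[j:=s])| ≤ (2ρ+1)·Σ_{t ∈ I_j} |∂_j v(x[j:=t])|`. [folklore] [cite: Giaquinta1984, Ch. III §1 p.65] -/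
theorem abs_sub_lineAvg_sum_le (z : Zd d) {ρ : ℤ} (hρ : 0 ≤ ρ) (j : Fin d) (v : Zd d → ℝ) {x : Zd d} (hx : x ∈ box z ρ) :
    ∑ s ∈ Finset.Icc (z j - ρ) (z j + ρ), |v x - v (Function.update x j s)| ≤
      ((2 * ρ + 1 : ℤ) : ℝ) * ∑ t ∈ Finset.Icc (z j - ρ) (z j + ρ), |fdiff j v (Function.update x j t)| := by
  classical
  set I := Finset.Icc (z j - ρ) (z j + ρ) with hI
  set V := ∑ t ∈ I, |fdiff j v (Function.update x j t)| with hV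
  -- telescoping between two points of the line: `|v(x[j:=a]) − v(x[j:=a+m])| ≤ Σ_{t<m} |∂_j v(x[j:=a+t])|`
  have step : ∀ (a : ℤ) (m : ℕ),
      |v (Function.update x j a) - v (Function.update x j (a + m))| ≤ ∑ t ∈ Finset.range m, |fdiff j v (Function.update x j (a + t))| := by
    intro a m
    induction m with
    | zero => simp
    | succ m ih =>
      have h2 : v (Function.update x j (a + m)) - v (Function.update x j (a + (m + 1 : ℕ))) = -fdiff j v (Function.update x j (a + m)) := by
        rw [fdiff]
        have : Function.update x j (a + m) + unitVec j = Function.update x j (a + ((m + 1 : ℕ) : ℤ)) := by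
          funext i
          by_cases hi : i = j
          · subst hi; simp; ring
          · simp [Function.update_of_ne hi, unitVec_apply_ne hi]
        rw [this]; ring
      rw [Finset.sum_range_succ]
      calc |v (Function.update x j a) - v (Function.update x j (a + (m + 1 : ℕ)))|
          = |(v (Function.update x j a) - v (Function.update x j (a + m))) + (v (Function.update x j (a + m)) - v (Function.update x j (a + (m + 1 : ℕ))))| := by
            ring_nf
        _ ≤ |v (Function.update x j a) - v (Function.update x j (a + m))| + |v (Function.update x j (a + m)) - v (Function.update x j (a + (m + 1 : ℕ)))| :=
            abs_add_le _ _
        _ ≤ ∑ t ∈ Finset.range m, |fdiff j v (Function.update x j (a + t))| + |fdiff j v (Function.update x j (a + (m : ℕ)))| := by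
            rw [h2, abs_neg]; linarith
  -- a range sum along the line inside `I` is at most `V`
  have range_le : ∀ (a : ℤ) (m : ℕ), a ∈ I → a + m ∈ I → ∑ t ∈ Finset.range m, |fdiff j v (Function.update x j (a + t))| ≤ V := by
    intro a m ha ham
    rw [hI, Finset.mem_Icc] at ha ham
    have hinj : ∀ t ∈ Finset.range m, ∀ t' ∈ Finset.range m, (fun t : ℕ => a + t) t = (fun t : ℕ => a + t) t' → t = t' := by
      intro t _ t' _ h; simp only [add_right_inj, Nat.cast_inj] at h; exact h
    rw [← Finset.sum_image (f := fun s => |fdiff j v (Function.update x j s)|) hinj]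
    refine Finset.sum_le_sum_of_subset_of_nonneg (fun s hs => ?_) fun _ _ _ => abs_nonneg _
    rw [Finset.mem_image] at hs
    obtain ⟨t, ht, rfl⟩ := hs
    rw [Finset.mem_range] at ht
    rw [hI, Finset.mem_Icc]; constructor
    · linarith [ha.1]
    · have : (t : ℤ) ≤ m := by exact_mod_cast ht.le
      linarith [ham.2]
  -- hence for any two points `s, s'` of the line: `|v(x[j:=s]) − v(x[j:=s'])| ≤ V`
  have pair : ∀ s ∈ I, ∀ s' ∈ I, |v (Function.update x j s) - v (Function.update x j s')| ≤ V := by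
    intro s hs s' hs'
    rcases le_total s s' with h | h
    · obtain ⟨m, hm⟩ : ∃ m : ℕ, s' = s + m := ⟨(s' - s).toNat, by rw [Int.toNat_of_nonneg (by linarith)]; ring⟩
      rw [hm] at hs' ⊢
      exact (step s m).trans (range_le s m hs hs')
    · obtain ⟨m, hm⟩ : ∃ m : ℕ, s = s' + m := ⟨(s - s').toNat, by rw [Int.toNat_of_nonneg (by linarith)]; ring⟩
      rw [hm] at hs ⊢
      rw [abs_sub_comm]
      exact (step s' m).trans (range_le s' m hs' hs)
  -- `x = x[j := x_j]` with `x_j ∈ I`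
  have hxj : x j ∈ I := by
    rw [hI, Finset.mem_Icc]; have := (mem_box.1 hx) j; rw [abs_le] at this; constructor <;> linarith [this.1, this.2]
  have hn : ((I.card : ℕ) : ℝ) = ((2 * ρ + 1 : ℤ) : ℝ) := by
    rw [hI, Int.card_Icc, show z j + ρ + 1 - (z j - ρ) = 2 * ρ + 1 by ring]
    have : (0 : ℤ) ≤ 2 * ρ + 1 := by linarith
    rw [← Int.cast_natCast, Int.toNat_of_nonneg this]
  calc ∑ s ∈ I, |v x - v (Function.update x j s)| ≤ ∑ s ∈ I, V := Finset.sum_le_sum fun s hs => by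
          have := pair (x j) hxj s hs; rwa [Function.update_eq_self] at this
    _ = ((2 * ρ + 1 : ℤ) : ℝ) * V := by rw [Finset.sum_const, nsmul_eq_mul, hn]

/-- **THE `ℓ¹` POINCARÉ INEQUALITY ON A BOX** (by averaging one coordinate at a time): for `ρ ≥ 0` there is a constant `c` with
`Σ_{x ∈ Q_ρ(z)} |u(x) − c| ≤ (2ρ+1)·Σ_{x ∈ Q_ρ(z)} Σ_μ |∂_μ u(x)|`.  (Induction on the set `T` of averaged coordinates: there is `w`, depending only on the
coordinates outside `T` on `Q`, with `Σ_Q |u − w| ≤ (2ρ+1) Σ_{i ∈ T} Σ_Q |∂_i u|` and `Σ_Q |∂_j w| ≤ Σ_Q |∂_j u|` for `j ∉ T`.)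
[folklore] [cite: Giaquinta1984, Ch. III §1 p.65; Balaban1984PropagatorsII, (1.9) p.226] -/
theorem exists_poincare_l1 (u : Zd d → ℝ) (z : Zd d) {ρ : ℤ} (hρ : 0 ≤ ρ) :
    ∃ c : ℝ, ∑ x ∈ box z ρ, |u x - c| ≤ ((2 * ρ + 1 : ℤ) : ℝ) * ∑ x ∈ box z ρ, ∑ μ, |fdiff μ u x| := by
  classical
  set Q := box z ρ with hQ
  set n : ℝ := ((2 * ρ + 1 : ℤ) : ℝ) with hn
  have hn0 : 0 < n := by rw [hn]; exact_mod_cast (show (0:ℤ) < 2 * ρ + 1 by linarith)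
  -- the inductive claim over the set of averaged coordinates
  have claim : ∀ T : Finset (Fin d), ∃ w : Zd d → ℝ,
      (∀ x ∈ Q, ∀ y ∈ Q, (∀ i, i ∉ T → x i = y i) → w x = w y) ∧
      (∀ j, j ∉ T → ∑ x ∈ Q, |fdiff j w x| ≤ ∑ x ∈ Q, |fdiff j u x|) ∧
      (∑ x ∈ Q, |u x - w x| ≤ n * ∑ i ∈ T, ∑ x ∈ Q, |fdiff i u x|) := by
    intro T
    induction T using Finset.induction_on with
    | empty =>
      refine ⟨u, fun x _ y _ h => ?_, fun j _ => le_rfl, by simp⟩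
      congr 1; funext i; exact h i (by simp)
    | insert j T hj ih =>
      obtain ⟨w, hconst, hgrad, hdev⟩ := ih
      -- the new function: average `w` over the `j`-th coordinate
      set I := Finset.Icc (z j - ρ) (z j + ρ) with hI
      refine ⟨fun x => (∑ s ∈ I, w (Function.update x j s)) / n, ?_, ?_, ?_⟩
      · -- depends only on coordinates outside `insert j T`
        intro x hx y hy hxy
        show (∑ s ∈ I, w (Function.update x j s)) / n = (∑ s ∈ I, w (Function.update y j s)) / n
        congr 1
        refine Finset.sum_congr rfl fun s hs => hconst _ (update_mem_box hx j hs) _ (update_mem_box hy j hs) fun i hi => ?_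
        by_cases hij : i = j
        · subst hij; simp
        · rw [Function.update_of_ne hij, Function.update_of_ne hij]
          exact hxy i (by simp [hij, hi])
      · -- gradients in the remaining directions do not increase
        intro j' hj'
        have hj'j : j' ≠ j := fun h => hj' (by simp [h])
        have hj'T : j' ∉ T := fun h => hj' (Finset.mem_insert_of_mem h)
        -- `∂_{j'}` commutes with the `j`-average
        have hcomm : ∀ x, fdiff j' (fun x => (∑ s ∈ I, w (Function.update x j s)) / n) x =
            (∑ s ∈ I, fdiff j' w (Function.update x j s)) / n := by
          intro x
          simp only [fdiff]
          rw [← sub_div, ← Finset.sum_sub_distrib]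
          congr 1
          refine Finset.sum_congr rfl fun s _ => ?_
          have : Function.update (x + unitVec j') j s = Function.update x j s + unitVec j' := by
            funext i
            by_cases hi : i = j
            · subst hi; simp [unitVec_apply_ne (Ne.symm hj'j)]
            · simp [Function.update_of_ne hi]
          rw [this]
        calc ∑ x ∈ Q, |fdiff j' (fun x => (∑ s ∈ I, w (Function.update x j s)) / n) x|
            = ∑ x ∈ Q, |∑ s ∈ I, fdiff j' w (Function.update x j s)| / n := by
              refine Finset.sum_congr rfl fun x _ => ?_; rw [hcomm, abs_div, abs_of_pos hn0]
          _ ≤ ∑ x ∈ Q, (∑ s ∈ I, |fdiff j' w (Function.update x j s)|) / n :=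
              Finset.sum_le_sum fun x _ => div_le_div_of_nonneg_right (Finset.abs_sum_le_sum_abs _ _) hn0.le
          _ = (∑ x ∈ Q, ∑ s ∈ I, |fdiff j' w (Function.update x j s)|) / n := by rw [Finset.sum_div]
          _ = ∑ x ∈ Q, |fdiff j' w x| := by
              rw [hQ, hI, sum_box_lineAvg z hρ j (fun x => |fdiff j' w x|), ← hQ, ← hn]; field_simp
          _ ≤ ∑ x ∈ Q, |fdiff j' u x| := hgrad j' hj'T
      · -- deviation: `Σ|u − A_j w| ≤ Σ|u − w| + Σ|w − A_j w|`
        have hdev' : ∑ x ∈ Q, |w x - (∑ s ∈ I, w (Function.update x j s)) / n| ≤ n * ∑ x ∈ Q, |fdiff j u x| := by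
          have h1 : ∀ x ∈ Q, |w x - (∑ s ∈ I, w (Function.update x j s)) / n| ≤ (∑ s ∈ I, |w x - w (Function.update x j s)|) / n := by
            intro x _
            have hcard : (I.card : ℝ) = n := by
              rw [hI, Int.card_Icc, show z j + ρ + 1 - (z j - ρ) = 2 * ρ + 1 by ring, hn]
              have : (0 : ℤ) ≤ 2 * ρ + 1 := by linarith
              rw [← Int.cast_natCast, Int.toNat_of_nonneg this]
            have e : w x - (∑ s ∈ I, w (Function.update x j s)) / n = (∑ s ∈ I, (w x - w (Function.update x j s))) / n := by
              rw [Finset.sum_sub_distrib, Finset.sum_const, nsmul_eq_mul, hcard]; field_simp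
            rw [e, abs_div, abs_of_pos hn0]
            exact div_le_div_of_nonneg_right (Finset.abs_sum_le_sum_abs _ _) hn0.le
          have h2 : ∀ x ∈ Q, (∑ s ∈ I, |w x - w (Function.update x j s)|) / n ≤ ∑ t ∈ I, |fdiff j w (Function.update x j t)| := by
            intro x hx
            rw [div_le_iff₀ hn0, mul_comm]
            exact abs_sub_lineAvg_sum_le z hρ j w hx
          calc ∑ x ∈ Q, |w x - (∑ s ∈ I, w (Function.update x j s)) / n|
              ≤ ∑ x ∈ Q, ∑ t ∈ I, |fdiff j w (Function.update x j t)| := Finset.sum_le_sum fun x hx => (h1 x hx).trans (h2 x hx)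
            _ = n * ∑ x ∈ Q, |fdiff j w x| := by rw [hQ, hI, sum_box_lineAvg z hρ j (fun x => |fdiff j w x|), ← hQ, ← hn]
            _ ≤ n * ∑ x ∈ Q, |fdiff j u x| := mul_le_mul_of_nonneg_left (hgrad j hj) hn0.le
        calc ∑ x ∈ Q, |u x - (∑ s ∈ I, w (Function.update x j s)) / n|
            ≤ ∑ x ∈ Q, (|u x - w x| + |w x - (∑ s ∈ I, w (Function.update x j s)) / n|) := Finset.sum_le_sum fun x _ => by
              have := abs_add_le (u x - w x) (w x - (∑ s ∈ I, w (Function.update x j s)) / n)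
              rwa [show u x - w x + (w x - (∑ s ∈ I, w (Function.update x j s)) / n) =
                u x - (∑ s ∈ I, w (Function.update x j s)) / n by ring] at this
          _ = ∑ x ∈ Q, |u x - w x| + ∑ x ∈ Q, |w x - (∑ s ∈ I, w (Function.update x j s)) / n| := Finset.sum_add_distrib
          _ ≤ n * ∑ i ∈ T, ∑ x ∈ Q, |fdiff i u x| + n * ∑ x ∈ Q, |fdiff j u x| := add_le_add hdev hdev'
          _ = n * ∑ i ∈ insert j T, ∑ x ∈ Q, |fdiff i u x| := by rw [Finset.sum_insert hj]; ring
  obtain ⟨w, hconst, _, hdev⟩ := claim Finset.univ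
  refine ⟨w z, ?_⟩
  calc ∑ x ∈ Q, |u x - w z| = ∑ x ∈ Q, |u x - w x| := Finset.sum_congr rfl fun x hx => by
          rw [hconst x hx z (self_mem_box z hρ) fun i hi => absurd (Finset.mem_univ i) hi]
    _ ≤ n * ∑ i ∈ (Finset.univ : Finset (Fin d)), ∑ x ∈ Q, |fdiff i u x| := hdev
    _ = n * ∑ x ∈ Q, ∑ μ, |fdiff μ u x| := by rw [Finset.sum_comm]

/-! ## §2 Comparing the constants of nested boxes -/

/-- `ℓ¹ ≤ √(#·ℓ²)` for the gradient on a box: `Σ_{x∈Q} Σ_μ |∂_μu(x)| ≤ √(d · #Q · gradSq u Q)`. [folklore] [cite: Giaquinta1984, Ch. III §1 p.65] -/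
theorem sum_abs_fdiff_le_sqrt (u : Zd d → ℝ) (Q : Finset (Zd d)) :
    ∑ x ∈ Q, ∑ μ, |fdiff μ u x| ≤ Real.sqrt (d * Q.card * gradSq u Q) := by
  classical
  apply Real.le_sqrt_of_sq_le
  have h := sq_sum_le_card_mul_sum_sq (s := Q ×ˢ (Finset.univ : Finset (Fin d))) (f := fun p => |fdiff p.2 u p.1|)
  rw [Finset.sum_product, Finset.card_product, Finset.card_univ, Fintype.card_fin] at h
  simp only [Finset.sum_product, sq_abs] at h
  rw [gradSq_def]
  calc (∑ x ∈ Q, ∑ μ, |fdiff μ u x|) ^ 2 ≤ ((Q.card * d : ℕ) : ℝ) * ∑ x ∈ Q, ∑ μ, fdiff μ u x ^ 2 := h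
    _ = d * Q.card * ∑ x ∈ Q, ∑ μ, fdiff μ u x ^ 2 := by push_cast; ring

/-- **NESTED BOXES**: let `Q_{ρ′}(z′) ⊆ Q_ρ(z)` with `0 ≤ ρ′ ≤ ρ`, `ρ + 1 ≤ 2(ρ′+1)`, let `c′, c` satisfy the `ℓ¹` Poincaré bounds on the two boxes, and let
`gradSq u (Q_ρ(z)) ≤ N (ρ+1)^{d−1}`.  Then `|c′ − c| ≤ √(16 d 8^d · N · (ρ+1))`. [folklore] [cite: Giaquinta1984, Ch. III §1 Thm 1.2 p.70] -/
theorem abs_sub_le_of_nested (hd : 1 ≤ d) (u : Zd d → ℝ) {z z' : Zd d} {ρ ρ' : ℤ} (hρ' : 0 ≤ ρ') (hρ'ρ : ρ' ≤ ρ) (hsub : box z' ρ' ⊆ box z ρ)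
    (hcomp : ρ + 1 ≤ 2 * (ρ' + 1)) {N : ℝ} (hN : 0 ≤ N) (hgrad : gradSq u (box z ρ) ≤ N * ((ρ : ℝ) + 1) ^ (d - 1)) {c c' : ℝ}
    (hc : ∑ x ∈ box z ρ, |u x - c| ≤ ((2 * ρ + 1 : ℤ) : ℝ) * ∑ x ∈ box z ρ, ∑ μ, |fdiff μ u x|)
    (hc' : ∑ x ∈ box z' ρ', |u x - c'| ≤ ((2 * ρ' + 1 : ℤ) : ℝ) * ∑ x ∈ box z' ρ', ∑ μ, |fdiff μ u x|) :
    |c' - c| ≤ Real.sqrt (16 * d * 8 ^ d * N * ((ρ : ℝ) + 1)) := by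
  classical
  have hρ : 0 ≤ ρ := hρ'.trans hρ'ρ
  set Q := box z ρ with hQ
  set Q' := box z' ρ' with hQ'
  set n : ℝ := ((2 * ρ + 1 : ℤ) : ℝ) with hn
  set n' : ℝ := ((2 * ρ' + 1 : ℤ) : ℝ) with hn'
  have hρR : (0 : ℝ) ≤ ρ := by exact_mod_cast hρ
  have hρ'R : (0 : ℝ) ≤ ρ' := by exact_mod_cast hρ'
  have hn_eq : n = 2 * (ρ : ℝ) + 1 := by rw [hn]; push_cast; ring
  have hn'_eq : n' = 2 * (ρ' : ℝ) + 1 := by rw [hn']; push_cast; ring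
  have hn0 : 0 < n := by rw [hn_eq]; linarith
  have hn'0 : 0 < n' := by rw [hn'_eq]; linarith
  have hρ'ρR : (ρ' : ℝ) ≤ ρ := by exact_mod_cast hρ'ρ
  have hnn' : n' ≤ n := by rw [hn_eq, hn'_eq]; linarith
  have hcardQ : (Q.card : ℝ) = n ^ d := by rw [hQ, card_box z hρ, hn]
  have hcardQ' : (Q'.card : ℝ) = n' ^ d := by rw [hQ', card_box z' hρ', hn']
  set G := ∑ x ∈ Q, ∑ μ, |fdiff μ u x| with hG
  have hG0 : 0 ≤ G := Finset.sum_nonneg fun _ _ => Finset.sum_nonneg fun _ _ => abs_nonneg _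
  -- `|c' − c|·#Q' ≤ Σ_{Q'} |u − c'| + Σ_{Q'} |u − c| ≤ n' G' + n G ≤ 2 n G`
  have h1 : (Q'.card : ℝ) * |c' - c| ≤ 2 * n * G := by
    have e : (Q'.card : ℝ) * |c' - c| = ∑ x ∈ Q', |c' - c| := by rw [Finset.sum_const, nsmul_eq_mul]
    rw [e]
    have h2 : ∑ x ∈ Q', |c' - c| ≤ ∑ x ∈ Q', (|u x - c'| + |u x - c|) := Finset.sum_le_sum fun x _ => by
      have := abs_sub_le c' (u x) c; rw [abs_sub_comm c' (u x)] at this; exact this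
    have h3 : ∑ x ∈ Q', |u x - c| ≤ ∑ x ∈ Q, |u x - c| := Finset.sum_le_sum_of_subset_of_nonneg hsub fun _ _ _ => abs_nonneg _
    have h4 : ∑ x ∈ Q', ∑ μ, |fdiff μ u x| ≤ G := Finset.sum_le_sum_of_subset_of_nonneg hsub fun _ _ _ => Finset.sum_nonneg fun _ _ => abs_nonneg _
    rw [Finset.sum_add_distrib] at h2
    have h5 : n' * ∑ x ∈ Q', ∑ μ, |fdiff μ u x| ≤ n * G := mul_le_mul hnn' h4 (Finset.sum_nonneg fun _ _ => Finset.sum_nonneg fun _ _ => abs_nonneg _) hn0.le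
    linarith
  -- `G ≤ √(d n^d N (ρ+1)^{d-1})`
  have h2 : G ≤ Real.sqrt (d * n ^ d * (N * ((ρ : ℝ) + 1) ^ (d - 1))) := by
    refine (sum_abs_fdiff_le_sqrt u Q).trans (Real.sqrt_le_sqrt ?_)
    rw [hcardQ]
    exact mul_le_mul_of_nonneg_left hgrad (by positivity)
  -- squares: `(#Q' |c'−c|)² ≤ 4 n² d n^d N (ρ+1)^{d−1}` and `#Q'^2 (16 d 8^d N (ρ+1)) ≥ that`
  have hkey : (|c' - c|) ^ 2 ≤ 16 * d * 8 ^ d * N * ((ρ : ℝ) + 1) := by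
    have hQ'pos : 0 < (Q'.card : ℝ) := by rw [hcardQ']; positivity
    have h3 : ((Q'.card : ℝ) * |c' - c|) ^ 2 ≤ (2 * n) ^ 2 * (d * n ^ d * (N * ((ρ : ℝ) + 1) ^ (d - 1))) := by
      have hA := pow_le_pow_left₀ (by positivity) (h1.trans (mul_le_mul_of_nonneg_left h2 (by positivity))) 2
      have e : (2 * n * Real.sqrt (d * n ^ d * (N * ((ρ : ℝ) + 1) ^ (d - 1)))) ^ 2 =
          (2 * n) ^ 2 * (Real.sqrt (d * n ^ d * (N * ((ρ : ℝ) + 1) ^ (d - 1)))) ^ 2 := by ring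
      rw [e, Real.sq_sqrt (by positivity)] at hA
      exact hA
    -- `n ≤ 2(ρ+1)`, `n'^d ≥ ((ρ+1)/2)^d`
    have hn2 : n ≤ 2 * ((ρ : ℝ) + 1) := by rw [hn_eq]; linarith
    have hcompR : ((ρ + 1 : ℤ) : ℝ) ≤ ((2 * (ρ' + 1) : ℤ) : ℝ) := by exact_mod_cast hcomp
    push_cast at hcompR
    have hn'2 : (ρ : ℝ) + 1 ≤ 2 * n' := by rw [hn'_eq]; linarith
    have hρ1 : (0 : ℝ) < (ρ : ℝ) + 1 := by linarith
    -- `(ρ+1)^{2d} (|c'-c|)^2 ≤ (2n')^{2d} |c'-c|^2 = 4^d (#Q' |c'-c|)^2 ≤ 4^d · 4n² · d n^d N (ρ+1)^{d-1} ≤ 4^d·16(ρ+1)²·d·2^d(ρ+1)^d·N(ρ+1)^{d−1}`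
    have h4 : ((ρ : ℝ) + 1) ^ (2 * d) * |c' - c| ^ 2 ≤ (4 : ℝ) ^ d * ((2 * n) ^ 2 * (d * n ^ d * (N * ((ρ : ℝ) + 1) ^ (d - 1)))) := by
      have e1 : (4 : ℝ) ^ d * ((Q'.card : ℝ) * |c' - c|) ^ 2 = (2 * n') ^ (2 * d) * |c' - c| ^ 2 := by
        rw [hcardQ', mul_pow, ← pow_mul, pow_mul (2 * n'), mul_pow (2:ℝ) n' 2, ← mul_pow]; ring
      have e2 : ((ρ : ℝ) + 1) ^ (2 * d) ≤ (2 * n') ^ (2 * d) := pow_le_pow_left₀ hρ1.le hn'2 _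
      calc ((ρ : ℝ) + 1) ^ (2 * d) * |c' - c| ^ 2 ≤ (2 * n') ^ (2 * d) * |c' - c| ^ 2 := mul_le_mul_of_nonneg_right e2 (sq_nonneg _)
        _ = (4 : ℝ) ^ d * ((Q'.card : ℝ) * |c' - c|) ^ 2 := e1.symm
        _ ≤ (4 : ℝ) ^ d * ((2 * n) ^ 2 * (d * n ^ d * (N * ((ρ : ℝ) + 1) ^ (d - 1)))) := mul_le_mul_of_nonneg_left h3 (by positivity)
    have h5 : (4 : ℝ) ^ d * ((2 * n) ^ 2 * (d * n ^ d * (N * ((ρ : ℝ) + 1) ^ (d - 1)))) ≤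
        ((ρ : ℝ) + 1) ^ (2 * d) * (16 * d * 8 ^ d * N * ((ρ : ℝ) + 1)) := by
      have e3 : n ^ d ≤ (2 * ((ρ : ℝ) + 1)) ^ d := pow_le_pow_left₀ hn0.le hn2 _
      have e4 : (2 * n) ^ 2 ≤ (4 * ((ρ : ℝ) + 1)) ^ 2 := pow_le_pow_left₀ (by positivity) (by linarith) _
      have e5 : ((ρ : ℝ) + 1) ^ (2 * d) * (16 * d * 8 ^ d * N * ((ρ : ℝ) + 1)) =
          (4 : ℝ) ^ d * ((4 * ((ρ : ℝ) + 1)) ^ 2 * (d * (2 * ((ρ : ℝ) + 1)) ^ d * (N * ((ρ : ℝ) + 1) ^ (d - 1)))) := by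
        have : ((ρ : ℝ) + 1) ^ (2 * d) * ((ρ : ℝ) + 1) = ((ρ : ℝ) + 1) ^ 2 * ((ρ : ℝ) + 1) ^ d * ((ρ : ℝ) + 1) ^ (d - 1) := by
          rw [← pow_succ, ← pow_add, ← pow_add]; congr 1; omega
        rw [show (8 : ℝ) ^ d = 4 ^ d * 2 ^ d by rw [← mul_pow]; norm_num, mul_pow (2 : ℝ) _ d, mul_pow (4 : ℝ) _ 2]
        calc ((ρ : ℝ) + 1) ^ (2 * d) * (16 * d * (4 ^ d * 2 ^ d) * N * ((ρ : ℝ) + 1))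
            = 16 * d * (4 ^ d * 2 ^ d) * N * (((ρ : ℝ) + 1) ^ (2 * d) * ((ρ : ℝ) + 1)) := by ring
          _ = 16 * d * (4 ^ d * 2 ^ d) * N * (((ρ : ℝ) + 1) ^ 2 * ((ρ : ℝ) + 1) ^ d * ((ρ : ℝ) + 1) ^ (d - 1)) := by rw [this]
          _ = (4 : ℝ) ^ d * ((4 : ℝ) ^ 2 * ((ρ : ℝ) + 1) ^ 2 * (d * (2 ^ d * ((ρ : ℝ) + 1) ^ d) * (N * ((ρ : ℝ) + 1) ^ (d - 1)))) := by ring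
      rw [e5]
      apply mul_le_mul_of_nonneg_left _ (by positivity)
      have hX : 0 ≤ d * n ^ d * (N * ((ρ : ℝ) + 1) ^ (d - 1)) := by positivity
      have hY : 0 ≤ (4 * ((ρ : ℝ) + 1)) ^ 2 := by positivity
      calc (2 * n) ^ 2 * (d * n ^ d * (N * ((ρ : ℝ) + 1) ^ (d - 1)))
          ≤ (4 * ((ρ : ℝ) + 1)) ^ 2 * (d * n ^ d * (N * ((ρ : ℝ) + 1) ^ (d - 1))) := mul_le_mul_of_nonneg_right e4 hX
        _ ≤ (4 * ((ρ : ℝ) + 1)) ^ 2 * (d * (2 * ((ρ : ℝ) + 1)) ^ d * (N * ((ρ : ℝ) + 1) ^ (d - 1))) := by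
            apply mul_le_mul_of_nonneg_left _ hY
            apply mul_le_mul_of_nonneg_right _ (by positivity)
            exact mul_le_mul_of_nonneg_left e3 (by positivity)
    have h6 := h4.trans h5
    have hp : (0 : ℝ) < ((ρ : ℝ) + 1) ^ (2 * d) := by positivity
    exact le_of_mul_le_mul_left (by linarith [h6]) hp
  have h0 : 0 ≤ 16 * d * 8 ^ d * N * ((ρ : ℝ) + 1) := by positivity
  calc |c' - c| = Real.sqrt (|c' - c| ^ 2) := by rw [Real.sqrt_sq (abs_nonneg _)]
    _ ≤ Real.sqrt (16 * d * 8 ^ d * N * ((ρ : ℝ) + 1)) := Real.sqrt_le_sqrt hkey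

/-! ## §3 Morrey's dyadic telescoping -/

/-- **DYADIC TELESCOPING AT ONE CENTRE**: if `gradSq u (Q_ρ(z)) ≤ N(ρ+1)^{d−1}` for all `0 ≤ ρ ≤ R₀`, then for every `0 ≤ ρ ≤ R₀` there is a constant `c`
with the `ℓ¹` Poincaré bound on `Q_ρ(z)` and `|u(z) − c| ≤ 8 √(16 d 8^d) · √(N (ρ+1))` (strong induction on `ρ` through `⌊ρ∕2⌋`: `√((3∕4))·8 + 1 ≤ 8`).
[folklore] [cite: Giaquinta1984, Ch. III §1 Thm 1.2 pp.70–72] -/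
theorem exists_const_near_value (hd : 1 ≤ d) (u : Zd d → ℝ) (z : Zd d) {N : ℝ} (hN : 0 ≤ N) {R₀ : ℤ}
    (hgrad : ∀ ρ : ℤ, 0 ≤ ρ → ρ ≤ R₀ → gradSq u (box z ρ) ≤ N * ((ρ : ℝ) + 1) ^ (d - 1)) :
    ∀ m : ℕ, (m : ℤ) ≤ R₀ → ∃ c : ℝ,
      ∑ x ∈ box z m, |u x - c| ≤ ((2 * (m : ℤ) + 1 : ℤ) : ℝ) * ∑ x ∈ box z m, ∑ μ, |fdiff μ u x| ∧
      |u z - c| ≤ 8 * Real.sqrt (16 * d * 8 ^ d) * Real.sqrt (N * ((m : ℝ) + 1)) := by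
  classical
  set C₁ : ℝ := Real.sqrt (16 * d * 8 ^ d) with hC₁
  have hC₁0 : 0 ≤ C₁ := Real.sqrt_nonneg _
  intro m
  induction m using Nat.strong_induction_on with
  | _ m ih =>
    intro hmR
    obtain ⟨c, hc⟩ := exists_poincare_l1 u z (show (0:ℤ) ≤ (m:ℤ) by positivity)
    refine ⟨c, hc, ?_⟩
    by_cases hm0 : m = 0
    · -- base: `Q_0(z) = {z}`
      subst hm0
      have hz : box z ((0 : ℕ) : ℤ) = {z} := by
        ext y; simp only [Nat.cast_zero, mem_box, Finset.mem_singleton, abs_nonpos_iff, sub_eq_zero]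
        constructor
        · intro h; funext i; exact h i
        · intro h i; rw [h]
      rw [hz] at hc
      simp only [Finset.sum_singleton, Nat.cast_zero, mul_zero, zero_add, Int.cast_one, one_mul] at hc
      have h1 : ∑ μ, |fdiff μ u z| ≤ Real.sqrt (d * 1 * gradSq u {z}) := by
        have := sum_abs_fdiff_le_sqrt u {z}; simpa using this
      have h2 : gradSq u {z} ≤ N := by
        have := hgrad 0 le_rfl (by exact_mod_cast hmR); rw [← hz]; simpa using this
      have h3 : Real.sqrt (d * 1 * gradSq u {z}) ≤ Real.sqrt (d * N) := Real.sqrt_le_sqrt (by rw [mul_one]; exact mul_le_mul_of_nonneg_left h2 (Nat.cast_nonneg d))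
      have h4 : Real.sqrt (d * N) ≤ 8 * C₁ * Real.sqrt N := by
        have h5 : Real.sqrt (d * N) ≤ Real.sqrt (16 * d * 8 ^ d * N) := Real.sqrt_le_sqrt (by
          have h8 : (1 : ℝ) ≤ 8 ^ d := one_le_pow₀ (by norm_num)
          nlinarith [mul_nonneg (Nat.cast_nonneg d) hN])
        have h6 : Real.sqrt (16 * d * 8 ^ d * N) = C₁ * Real.sqrt N := by rw [hC₁, ← Real.sqrt_mul (by positivity)]
        have h0 : 0 ≤ C₁ * Real.sqrt N := by positivity
        linarith
      have e : Real.sqrt (N * (((0 : ℕ) : ℝ) + 1)) = Real.sqrt N := by simp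
      rw [e]
      exact hc.trans (h1.trans (h3.trans h4))
    · -- step through `m' = m / 2`
      set m' := m / 2 with hm'
      have hm'lt : m' < m := by omega
      have hm'R : (m' : ℤ) ≤ R₀ := le_trans (by exact_mod_cast hm'lt.le) hmR
      obtain ⟨c', hc', hzc'⟩ := ih m' hm'lt hm'R
      have hsub : box z (m' : ℤ) ⊆ box z (m : ℤ) := box_mono z (by exact_mod_cast hm'lt.le)
      have hcomp : (m : ℤ) + 1 ≤ 2 * ((m' : ℤ) + 1) := by omega
      have hnest := abs_sub_le_of_nested hd u (by positivity) (by exact_mod_cast hm'lt.le) hsub hcomp hN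
        (by have := hgrad m (by positivity) hmR; push_cast at this ⊢; exact this) (by push_cast at hc ⊢; exact hc) (by push_cast at hc' ⊢; exact hc')
      -- `|u z − c| ≤ |u z − c'| + |c' − c|`
      have htri : |u z - c| ≤ |u z - c'| + |c' - c| := by
        have := abs_add_le (u z - c') (c' - c); rwa [show u z - c' + (c' - c) = u z - c by ring] at this
      -- `√(N(m'+1)) ≤ √(3/4) √(N(m+1))` and `8√(3/4) + 1 ≤ 8`
      have hm'le : ((m' : ℝ) + 1) ≤ 3 / 4 * ((m : ℝ) + 1) := by
        have : 4 * ((m' : ℝ) + 1) ≤ 3 * ((m : ℝ) + 1) := by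
          have h : 4 * (m' + 1) ≤ 3 * (m + 1) := by omega
          exact_mod_cast h
        linarith
      have hsq : Real.sqrt (N * ((m' : ℝ) + 1)) ≤ Real.sqrt (3 / 4) * Real.sqrt (N * ((m : ℝ) + 1)) := by
        rw [← Real.sqrt_mul (by norm_num)]
        exact Real.sqrt_le_sqrt (by nlinarith)
      have h34 : Real.sqrt (3 / 4) ≤ 7 / 8 := by
        rw [Real.sqrt_le_left (by norm_num)]; norm_num
      have hS0 : 0 ≤ Real.sqrt (N * ((m : ℝ) + 1)) := Real.sqrt_nonneg _
      have hmcast : ((m : ℤ) : ℝ) = (m : ℝ) := by norm_cast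
      rw [hmcast] at hnest
      calc |u z - c| ≤ |u z - c'| + |c' - c| := htri
        _ ≤ 8 * C₁ * Real.sqrt (N * ((m' : ℝ) + 1)) + C₁ * Real.sqrt (N * ((m : ℝ) + 1)) := by
            refine add_le_add hzc' ?_
            rw [hC₁, ← Real.sqrt_mul (by positivity)]
            exact hnest.trans (Real.sqrt_le_sqrt (by ring_nf; rfl))
        _ ≤ 8 * C₁ * (Real.sqrt (3 / 4) * Real.sqrt (N * ((m : ℝ) + 1))) + C₁ * Real.sqrt (N * ((m : ℝ) + 1)) := by
            have := mul_le_mul_of_nonneg_left hsq (by positivity : (0:ℝ) ≤ 8 * C₁); linarith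
        _ ≤ 8 * C₁ * Real.sqrt (N * ((m : ℝ) + 1)) := by
            have : 8 * C₁ * (Real.sqrt (3 / 4) * Real.sqrt (N * ((m : ℝ) + 1))) ≤ 8 * C₁ * ((7 / 8) * Real.sqrt (N * ((m : ℝ) + 1))) :=
              mul_le_mul_of_nonneg_left (mul_le_mul_of_nonneg_right h34 hS0) (by positivity)
            nlinarith

/-- **MORREY'S CONCLUSION FOR TWO CENTRES.**  If `x′ ∈ Q_{ρ₀}(a)` with `1 ≤ ρ₀`, `2ρ₀ ≤ R₀`, and `gradSq u (Q_ρ(z)) ≤ N(ρ+1)^{d−1}` for all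
`0 ≤ ρ ≤ R₀` at both centres `z ∈ {a, x′}`, then `|u(x′) − u(a)| ≤ 17·√(16 d 8^d)·√(N(2ρ₀+1))` (telescoping at `a` to radius `ρ₀`, at `x′` to radius `2ρ₀`,
and `Q_{ρ₀}(a) ⊆ Q_{2ρ₀}(x′)` for the middle term).  With `N ≍ K^{−1}M²` this is the `C^{1∕2}` modulus `(ρ₀∕K)^{1∕2}·M`.
[folklore] [cite: Giaquinta1984, Ch. III §1 Thm 1.2 pp.70–72; Balaban1984PropagatorsII, (1.9) p.226] -/
theorem abs_sub_le_of_morrey (hd : 1 ≤ d) (u : Zd d → ℝ) {a x' : Zd d} {ρ₀ : ℕ} (hρ₀ : 1 ≤ ρ₀) (hx' : x' ∈ box a (ρ₀ : ℤ)) {N : ℝ} (hN : 0 ≤ N)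
    {R₀ : ℤ} (hR₀ : 2 * (ρ₀ : ℤ) ≤ R₀)
    (hgrad_a : ∀ ρ : ℤ, 0 ≤ ρ → ρ ≤ R₀ → gradSq u (box a ρ) ≤ N * ((ρ : ℝ) + 1) ^ (d - 1))
    (hgrad_x : ∀ ρ : ℤ, 0 ≤ ρ → ρ ≤ R₀ → gradSq u (box x' ρ) ≤ N * ((ρ : ℝ) + 1) ^ (d - 1)) :
    |u x' - u a| ≤ 17 * Real.sqrt (16 * d * 8 ^ d) * Real.sqrt (N * (2 * (ρ₀ : ℝ) + 1)) := by
  set C₁ : ℝ := Real.sqrt (16 * d * 8 ^ d) with hC₁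
  have hC₁0 : 0 ≤ C₁ := Real.sqrt_nonneg _
  obtain ⟨ca, hca, hzca⟩ := exists_const_near_value hd u a hN hgrad_a ρ₀ (by linarith)
  obtain ⟨cx, hcx, hzcx⟩ := exists_const_near_value hd u x' hN hgrad_x (2 * ρ₀) (by push_cast; exact hR₀)
  -- the middle term: `Q_{ρ₀}(a) ⊆ Q_{2ρ₀}(x′)`
  have hsub : box a (ρ₀ : ℤ) ⊆ box x' ((2 * ρ₀ : ℕ) : ℤ) := box_subset_box fun i => by
    have := (mem_box.1 hx') i; rw [abs_sub_comm] at this; push_cast; linarith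
  have hmid := abs_sub_le_of_nested hd u (z := x') (z' := a) (ρ := ((2 * ρ₀ : ℕ) : ℤ)) (ρ' := (ρ₀ : ℤ)) (by positivity)
    (by push_cast; linarith) hsub (by push_cast; linarith) hN
    (by have := hgrad_x ((2 * ρ₀ : ℕ) : ℤ) (by positivity) (by push_cast; exact hR₀); exact this) hcx hca
  have hS0 : 0 ≤ Real.sqrt (N * (2 * (ρ₀ : ℝ) + 1)) := Real.sqrt_nonneg _
  have e2 : (((2 * ρ₀ : ℕ) : ℤ) : ℝ) + 1 = 2 * (ρ₀ : ℝ) + 1 := by push_cast; ring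
  have e2' : ((2 * ρ₀ : ℕ) : ℝ) + 1 = 2 * (ρ₀ : ℝ) + 1 := by push_cast; ring
  -- `√(N(ρ₀+1)) ≤ √(N(2ρ₀+1))`
  have hmono : Real.sqrt (N * ((ρ₀ : ℝ) + 1)) ≤ Real.sqrt (N * (2 * (ρ₀ : ℝ) + 1)) :=
    Real.sqrt_le_sqrt (by nlinarith [Nat.cast_nonneg (α := ℝ) ρ₀])
  have h1 : |u a - ca| ≤ 8 * C₁ * Real.sqrt (N * (2 * (ρ₀ : ℝ) + 1)) :=
    hzca.trans (mul_le_mul_of_nonneg_left hmono (by positivity))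
  have h2 : |u x' - cx| ≤ 8 * C₁ * Real.sqrt (N * (2 * (ρ₀ : ℝ) + 1)) := by rw [← e2']; exact hzcx
  have h3 : |ca - cx| ≤ C₁ * Real.sqrt (N * (2 * (ρ₀ : ℝ) + 1)) := by
    rw [hC₁, ← Real.sqrt_mul (by positivity), ← e2]
    exact hmid.trans (Real.sqrt_le_sqrt (by ring_nf; rfl))
  have htri : |u x' - u a| ≤ |u x' - cx| + |ca - cx| + |u a - ca| := by
    have e : u x' - u a = (u x' - cx) + (cx - ca) - (u a - ca) := by ring
    rw [e]
    calc |(u x' - cx) + (cx - ca) - (u a - ca)| ≤ |(u x' - cx) + (cx - ca)| + |u a - ca| := abs_sub _ _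
      _ ≤ |u x' - cx| + |cx - ca| + |u a - ca| := by linarith [abs_add_le (u x' - cx) (cx - ca)]
      _ = |u x' - cx| + |ca - cx| + |u a - ca| := by rw [abs_sub_comm cx ca]
  calc |u x' - u a| ≤ |u x' - cx| + |ca - cx| + |u a - ca| := htri
    _ ≤ 8 * C₁ * Real.sqrt (N * (2 * (ρ₀ : ℝ) + 1)) + C₁ * Real.sqrt (N * (2 * (ρ₀ : ℝ) + 1)) + 8 * C₁ * Real.sqrt (N * (2 * (ρ₀ : ℝ) + 1)) :=
        add_le_add (add_le_add h2 h3) h1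
    _ = 17 * C₁ * Real.sqrt (N * (2 * (ρ₀ : ℝ) + 1)) := by ring

end Literature.MathematicalPhysics.QuantumFieldTheory.Balaban1983to89.B4Eq19LatticePoincareMorrey

end
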